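import Literature.NumberTheory.Automorphic.UnramifiedTraceZeroLatticeIndex   -- ★ `mem_ker_id_add_iff`, `mem_ker_id_sub_iff`; brings ★ `SubgroupIndexDevissage` (`relIndex_leAddSubgroup_exp`, `_ne_zero`)
import HarnessLib

/-!
# The ANTI-FIXED integers `𝒪⁰ = {x ∈ 𝒪 : σx = −x}` of a valued field with ANY isometric involution `σ`: `[𝒪⁰ : 𝒪⁰ ∩ 𝔭^{2j}] ≤ D · q^j`
# (ramified, wild, dyadic alike — no (trace)∕(norm), no `σ`-fixed uniformiser; Serre, *Corps locaux* II §3, V §2–§3)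

Track B ∕ K2-LIT, hLiu418 = stmt-HodgeConjecture-24832; socket #32dR `sig_K2LiuDoublingHeightDecayLocalR2` (U5d ED. 5 :554); LEAD F0P6-plan (g11) deal (26-r) →
K2Liu-p04 (g4); REPORT-FIRST `K2/K2Liu-p04/g4/REPORT-FIRST-26r-IsotropicAnyPlace.K2Liup04g4.md` (F2b).  With ★ (F2a) `K2LiuRankOneCosetCoverAnyPlace` (the
double coset `K₀·diag(ϖ^j, (σϖ^j)⁻¹)·K₀` of `U(σ, J₀)` is covered by `2·#net` left cosets, for a net of `𝒪⁰` modulo `v ≤ exp(−2j)`) THIS FILE bounds the net: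
the VOLUME GROWTH `ν(K₀ b_j K₀) ≤ C₁·q^j` of the rank-one Cartan family at ANY non-split place (the `Q = q_w` of the closer's datum).

Unlike ★ `UnramifiedTraceZeroLatticeIndex` (which evaluates `[𝒪⁰ : ϖ^k 𝒪⁰] = (√q)^k` EXACTLY from the (trace) axiom of an UNRAMIFIED datum with a `σ`-fixed
uniformiser), here `σ` is an arbitrary involution with `v ∘ σ = v` (so the quadratic extension `K ∕ K^σ` may be ramified, even wildly), and only an UPPER BOUND
of the right order is proved — all #32dR needs.  Write `B_γ = {v ≤ γ}`, `L_γ = B_γ ∩ ker(id + σ)` (anti-fixed = trace-zero ball), `F_γ = B_γ ∩ ker(id − σ)`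
(fixed ball), `q = #𝓀`.

* §1 `exists_antifixed_integral` — if `σ ≠ id` there is an anti-fixed `θ ≠ 0` with `v θ = exp(−k) ≤ 1` (`(x − σx)·(ϖσϖ)^n`).
  `map_mulLeft_fixedBall`, `map_mulLeft_antifixedBall` — multiplication by an anti-fixed `ξ ≠ 0` SWAPS the two filtrations: `ξ·F_γ = L_{v(ξ)γ}`,
  `ξ·L_γ = F_{v(ξ)γ}` (the datum-free content of ★ `map_mulLeft_leAddSubgroup_inf_ker_sub`); hence `[F_{v θ} : F_{v(θ)γ}] = [L_1 : L_γ]`.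
* §2 `relIndex_antifixedBall_ne_zero ∕ _le`, `relIndex_fixedBall_ne_zero` — `[L_1 : L_{exp(−n)}] ≤ [B_1 : B_{exp(−n)}] = q^n` (★ `relIndex_leAddSubgroup_exp`).
* §3 **`relIndex_fixed_mul_antifixed_le`** — `[F_1 : F_{exp(−m)}]·[L_1 : L_{exp(−m)}] ≤ q^{m+t}` where `v(2) = exp(−t)`: the map `([a],[b]) ↦ [a + b]` into
  `B_1 ∕ B_{exp(−(m+t))}` is injective (`y = (b₁−a₁)+(b₂−a₂)` small ⇒ `2(b₁−a₁) = y + σy` small).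
* §4 **`relIndex_antifixedBall_sq_le`**, **`exists_relIndex_antifixedBall_le`** — `b_i := [L_1 : L_{exp(−i)}]` satisfies `b_i ≤ [F_{−k} : F_{−(k+i)}]·… ≤ [F_1 : F_{−(k+i)}]`,
  `b_i ≤ b_{k+i}`, so `b_i² ≤ q^{k+i+t}` and **`[L_1 : L_{exp(−2j)}] ≤ q^{k+t}·q^j`**.
* §5 `exists_net_of_relIndex_ne_zero` — a finite-index pair `T ≤ S` of additive subgroups has a net `R₀ ⊆ S` of `≤ [S:T]` points (representatives).
Theorems only; no `def`, no `sorry`, default heartbeats.  [Serre1979, Ch. II §3 Prop. 5, Ch. V §3]; [Jacobowitz1962, §§7–9]; [Rogawski1990, §1.10 p. 14].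
HONEST LABEL: HC_CM is proved only modulo the 7 printed citations (2 remaining named inputs: hLiu418 = stmt-HodgeConjecture-24832, h413 =
stmt-HodgeConjecture-24833) until rung 0 closes; count-neutral helper toward #32dR (organ (26-r)), retires nothing by itself.
-/

set_option autoImplicit false
-- the mandated namespace repeats the single-problem summit's segment (`HodgeConjecture.HodgeConjecture`)
set_option linter.dupNamespace false

noncomputable section

open scoped Valued WithZero

namespace Summit.HodgeConjecture.HodgeConjecture.Cruxes.HLiu418.K2LiuAntifixedLatticeIndex

open Literature.NumberTheory.Automorphic Literature.NumberTheory.Automorphic.HermitianLattice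

variable {K : Type*} [Field K] [Valued K ℤᵐ⁰] {σ : K →+* K} {ϖ : K}

/-! ## §1 An anti-fixed integral element; the swap of the fixed and anti-fixed filtrations -/

/-- `exp m ≠ 0` in `ℤᵐ⁰`. [folklore] -/
theorem exp_ne_zero' (m : ℤ) : (WithZero.exp m : ℤᵐ⁰) ≠ 0 := WithZero.coe_ne_zero

/-- **an anti-fixed integral element**: if `σ ≠ id` (`σ` an involution with `v ∘ σ = v`, `ϖ` a uniformiser) there is `θ` with `σθ = −θ`, `θ ≠ 0`,
`v θ = exp(−k)` for some `k ∈ ℕ` (`(x − σx)·(ϖσϖ)^n`; `ϖσϖ` is `σ`-fixed of valuation `exp(−2)`). [cite: Serre1979, Ch. V §3] [cite: Rogawski1990, §1.10 p. 14] -/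
theorem exists_antifixed_integral (hσ : ∀ x, σ (σ x) = x) (hvσ : ∀ x, Valued.v (σ x) = Valued.v x)
    (hϖ : Valued.v ϖ = WithZero.exp (-1 : ℤ)) (hne : ∃ x : K, σ x ≠ x) :
    ∃ (θ : K) (k : ℕ), σ θ = -θ ∧ θ ≠ 0 ∧ Valued.v θ = WithZero.exp (-(k : ℤ)) := by
  obtain ⟨x, hx⟩ := hne
  set y : K := x - σ x with hy
  have hy0 : y ≠ 0 := sub_ne_zero.2 (Ne.symm hx)
  have hσy : σ y = -y := by rw [hy, map_sub, hσ, neg_sub]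
  have hvy : Valued.v y ≠ 0 := (Valuation.ne_zero_iff _).2 hy0
  obtain ⟨m, hm⟩ : ∃ m : ℤ, Valued.v y = WithZero.exp m := ⟨_, (WithZero.exp_log hvy).symm⟩
  have hϖ0 : ϖ ≠ 0 := fun h => by rw [h, map_zero] at hϖ; exact WithZero.coe_ne_zero hϖ.symm
  set π : K := ϖ * σ ϖ with hπ
  have hσπ : σ π = π := by rw [hπ, map_mul, hσ, mul_comm]
  have hvπ : Valued.v π = WithZero.exp (-2 : ℤ) := by
    rw [hπ, map_mul, hvσ, hϖ, ← WithZero.exp_add]; norm_num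
  refine ⟨y * π ^ m.toNat, (2 * (m.toNat : ℤ) - m).toNat, ?_, mul_ne_zero hy0 (pow_ne_zero _ (mul_ne_zero hϖ0 (by rwa [ne_eq, ← map_zero σ,
      (RingHom.injective σ).eq_iff]))), ?_⟩
  · rw [map_mul, map_pow, hσπ, hσy, neg_mul]
  · rw [map_mul, map_pow, hm, hvπ, ← WithZero.exp_nsmul, ← WithZero.exp_add]
    congr 1
    have h1 : m ≤ 2 * (m.toNat : ℤ) := by have := Int.self_le_toNat m; omega
    have h2 : (((2 * (m.toNat : ℤ) - m).toNat : ℕ) : ℤ) = 2 * (m.toNat : ℤ) - m := Int.toNat_of_nonneg (by omega)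
    rw [h2, nsmul_eq_mul]
    ring

omit [Valued K ℤᵐ⁰] in
/-- for `σ ξ = −ξ`: `σ x = x ⇒ σ(ξx) = −ξx`. [cite: Serre1979, Ch. V §3] -/
theorem map_mul_of_fixed {ξ x : K} (hξ : σ ξ = -ξ) (hx : σ x = x) : σ (ξ * x) = -(ξ * x) := by
  rw [map_mul, hξ, hx, neg_mul]

omit [Valued K ℤᵐ⁰] in
/-- for `σ ξ = −ξ`: `σ x = −x ⇒ σ(ξx) = ξx`. [cite: Serre1979, Ch. V §3] -/
theorem map_mul_of_antifixed {ξ x : K} (hξ : σ ξ = -ξ) (hx : σ x = -x) : σ (ξ * x) = ξ * x := by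
  rw [map_mul, hξ, hx, neg_mul_neg]

/-- **`ξ · F_γ = L_{v(ξ)γ}`** for an anti-fixed `ξ ≠ 0` (fixed ball ↦ anti-fixed ball). [cite: Serre1979, Ch. V §3] [cite: Rogawski1990, §1.10 p. 14] -/
theorem map_mulLeft_fixedBall {ξ : K} (hξ : σ ξ = -ξ) (hξ0 : ξ ≠ 0) (γ : ℤᵐ⁰) :
    ((Valued.v : Valuation K ℤᵐ⁰).leAddSubgroup γ ⊓ (AddMonoidHom.id K - σ.toAddMonoidHom).ker).map (AddMonoidHom.mulLeft ξ) =
      (Valued.v : Valuation K ℤᵐ⁰).leAddSubgroup (Valued.v ξ * γ) ⊓ (AddMonoidHom.id K + σ.toAddMonoidHom).ker := by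
  ext y
  simp only [AddSubgroup.mem_map, AddSubgroup.mem_inf, Valuation.mem_leAddSubgroup_iff, AddMonoidHom.coe_mulLeft, mem_ker_id_add_iff,
    mem_ker_id_sub_iff]
  constructor
  · rintro ⟨x, ⟨hx, hxσ⟩, rfl⟩
    refine ⟨by rw [map_mul]; exact mul_le_mul_right hx _, ?_⟩
    rw [map_mul_of_fixed hξ hxσ, add_neg_cancel]
  · rintro ⟨hy, hyσ⟩
    have hvξ : Valued.v ξ ≠ 0 := (Valuation.ne_zero_iff _).2 hξ0
    refine ⟨ξ⁻¹ * y, ⟨?_, ?_⟩, by rw [mul_inv_cancel_left₀ hξ0]⟩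
    · rw [map_mul, map_inv₀]
      calc (Valued.v ξ)⁻¹ * Valued.v y ≤ (Valued.v ξ)⁻¹ * (Valued.v ξ * γ) := mul_le_mul_right hy _
        _ = γ := by rw [inv_mul_cancel_left₀ hvξ]
    · have hyσ' : σ y = -y := eq_neg_of_add_eq_zero_right hyσ
      rw [map_mul, map_inv₀, hξ, hyσ', inv_neg, neg_mul_neg]

/-- **`ξ · L_γ = F_{v(ξ)γ}`** for an anti-fixed `ξ ≠ 0` (anti-fixed ball ↦ fixed ball). [cite: Serre1979, Ch. V §3] [cite: Rogawski1990, §1.10 p. 14] -/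
theorem map_mulLeft_antifixedBall {ξ : K} (hξ : σ ξ = -ξ) (hξ0 : ξ ≠ 0) (γ : ℤᵐ⁰) :
    ((Valued.v : Valuation K ℤᵐ⁰).leAddSubgroup γ ⊓ (AddMonoidHom.id K + σ.toAddMonoidHom).ker).map (AddMonoidHom.mulLeft ξ) =
      (Valued.v : Valuation K ℤᵐ⁰).leAddSubgroup (Valued.v ξ * γ) ⊓ (AddMonoidHom.id K - σ.toAddMonoidHom).ker := by
  ext y
  simp only [AddSubgroup.mem_map, AddSubgroup.mem_inf, Valuation.mem_leAddSubgroup_iff, AddMonoidHom.coe_mulLeft, mem_ker_id_add_iff,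
    mem_ker_id_sub_iff]
  constructor
  · rintro ⟨x, ⟨hx, hxσ⟩, rfl⟩
    exact ⟨by rw [map_mul]; exact mul_le_mul_right hx _, map_mul_of_antifixed hξ (eq_neg_of_add_eq_zero_right hxσ)⟩
  · rintro ⟨hy, hyσ⟩
    have hvξ : Valued.v ξ ≠ 0 := (Valuation.ne_zero_iff _).2 hξ0
    refine ⟨ξ⁻¹ * y, ⟨?_, ?_⟩, by rw [mul_inv_cancel_left₀ hξ0]⟩
    · rw [map_mul, map_inv₀]
      calc (Valued.v ξ)⁻¹ * Valued.v y ≤ (Valued.v ξ)⁻¹ * (Valued.v ξ * γ) := mul_le_mul_right hy _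
        _ = γ := by rw [inv_mul_cancel_left₀ hvξ]
    · rw [map_mul, map_inv₀, hξ, hyσ, inv_neg, neg_mul, add_neg_cancel]

/-- **the swap identifies the indices**: `[F_{v(θ)} : F_{v(θ)·γ}] = [L_1 : L_γ]` for an anti-fixed `θ ≠ 0` (multiplication by `θ` is an additive
isomorphism `L_γ ≃ F_{v(θ)γ}`). [cite: Serre1979, Ch. V §3] -/
theorem relIndex_fixedBall_shift_eq {θ : K} (hθ : σ θ = -θ) (hθ0 : θ ≠ 0) (γ : ℤᵐ⁰) :
    ((Valued.v : Valuation K ℤᵐ⁰).leAddSubgroup (Valued.v θ * γ) ⊓ (AddMonoidHom.id K - σ.toAddMonoidHom).ker).relIndex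
        ((Valued.v : Valuation K ℤᵐ⁰).leAddSubgroup (Valued.v θ) ⊓ (AddMonoidHom.id K - σ.toAddMonoidHom).ker) =
      ((Valued.v : Valuation K ℤᵐ⁰).leAddSubgroup γ ⊓ (AddMonoidHom.id K + σ.toAddMonoidHom).ker).relIndex
        ((Valued.v : Valuation K ℤᵐ⁰).leAddSubgroup 1 ⊓ (AddMonoidHom.id K + σ.toAddMonoidHom).ker) := by
  have hinj : Function.Injective (AddMonoidHom.mulLeft θ) := mul_right_injective₀ hθ0
  rw [← AddSubgroup.relIndex_map_map_of_injective ((Valued.v : Valuation K ℤᵐ⁰).leAddSubgroup γ ⊓ (AddMonoidHom.id K + σ.toAddMonoidHom).ker)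
    ((Valued.v : Valuation K ℤᵐ⁰).leAddSubgroup 1 ⊓ (AddMonoidHom.id K + σ.toAddMonoidHom).ker) hinj,
    map_mulLeft_antifixedBall hθ hθ0, map_mulLeft_antifixedBall hθ hθ0, mul_one]

/-! ## §2 The anti-fixed and fixed balls have finite index, at most `q^n` -/

/-- `L_{exp(−n)} = B_{exp(−n)} ⊓ L_1` (and the same for any additive subgroup in place of `ker`). [folklore] -/
theorem inf_ker_eq_inf_inf (n : ℕ) (S : AddSubgroup K) :
    (Valued.v : Valuation K ℤᵐ⁰).leAddSubgroup (WithZero.exp (-(n : ℤ))) ⊓ S =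
      (Valued.v : Valuation K ℤᵐ⁰).leAddSubgroup (WithZero.exp (-(n : ℤ))) ⊓ ((Valued.v : Valuation K ℤᵐ⁰).leAddSubgroup 1 ⊓ S) := by
  rw [← inf_assoc]
  congr 1
  refine (inf_of_le_left (Valuation.leAddSubgroup_monotone _ ?_)).symm
  rw [← WithZero.exp_zero, WithZero.exp_le_exp]
  omega

/-- **`[S_1 : S_{exp(−n)}] ≠ 0` and `≤ q^n`** for `S_γ = B_γ ⊓ S`, `S` any additive subgroup (e.g. `ker(id ± σ)`): the quotient embeds into `B_1 ∕ B_{exp(−n)}`.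
[cite: Serre1979, Ch. II §3 Prop. 5] -/
theorem relIndex_ball_inf_le (hϖ : Valued.v ϖ = WithZero.exp (-1 : ℤ)) [Finite 𝓀[K]] (n : ℕ) (S : AddSubgroup K) :
    ((Valued.v : Valuation K ℤᵐ⁰).leAddSubgroup (WithZero.exp (-(n : ℤ))) ⊓ S).relIndex ((Valued.v : Valuation K ℤᵐ⁰).leAddSubgroup 1 ⊓ S) ≠ 0 ∧
    ((Valued.v : Valuation K ℤᵐ⁰).leAddSubgroup (WithZero.exp (-(n : ℤ))) ⊓ S).relIndex ((Valued.v : Valuation K ℤᵐ⁰).leAddSubgroup 1 ⊓ S) ≤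
      Nat.card 𝓀[K] ^ n := by
  have hB : ((Valued.v : Valuation K ℤᵐ⁰).leAddSubgroup (WithZero.exp (-(n : ℤ)))).relIndex ((Valued.v : Valuation K ℤᵐ⁰).leAddSubgroup 1) =
      Nat.card 𝓀[K] ^ n := by
    rw [← WithZero.exp_zero, relIndex_leAddSubgroup_exp hϖ]
    congr 1
    omega
  have hB0 : ((Valued.v : Valuation K ℤᵐ⁰).leAddSubgroup (WithZero.exp (-(n : ℤ)))).relIndex ((Valued.v : Valuation K ℤᵐ⁰).leAddSubgroup 1) ≠ 0 := by
    rw [hB]; exact pow_ne_zero _ (Nat.card_pos (α := 𝓀[K])).ne'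
  rw [inf_ker_eq_inf_inf n S, AddSubgroup.inf_relIndex_right]
  refine ⟨?_, ?_⟩
  · have h := AddSubgroup.relIndex_inter_ne_zero hB0 S
    rwa [inf_ker_eq_inf_inf n S, AddSubgroup.inf_relIndex_right] at h
  · rw [← hB]
    exact AddSubgroup.relIndex_le_of_le_right inf_le_left hB0

/-! ## §3 The product bound `[F_1 : F_{exp(−m)}] · [L_1 : L_{exp(−m)}] ≤ q^{m+t}`, `v(2) = exp(−t)` -/

/-- the valuation of a fixed∕anti-fixed part is controlled by `2`: `v(2z) ≤ exp(−(m+t))`, `v 2 = exp(−t)` ⟹ `v z ≤ exp(−m)`. [cite: Serre1979, Ch. V §3] -/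
theorem v_le_of_v_two_mul_le {t m : ℕ} (h2 : Valued.v (2 : K) = WithZero.exp (-(t : ℤ))) {z : K}
    (hz : Valued.v (2 * z) ≤ WithZero.exp (-((m : ℤ) + t))) : Valued.v z ≤ WithZero.exp (-(m : ℤ)) := by
  rw [map_mul, h2, mul_comm] at hz
  have hpos : (0 : ℤᵐ⁰) < WithZero.exp (-(t : ℤ)) := zero_lt_iff.2 (exp_ne_zero' _)
  rw [← le_div_iff₀ hpos, ← WithZero.exp_sub] at hz
  convert hz using 2
  omega

/-- **THE PRODUCT BOUND.**  For `σ` an involution with `v ∘ σ = v` and `v(2) = exp(−t)`: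
`[F_1 : F_{exp(−m)}] · [L_1 : L_{exp(−m)}] ≤ [B_1 : B_{exp(−(m+t))}] = q^{m+t}` — the map `([a],[b]) ↦ [a+b]` is injective, because for
`y = (b₁−a₁) + (b₂−a₂)` one has `y + σy = 2(b₁−a₁)` and `y − σy = 2(b₂−a₂)`. [cite: Serre1979, Ch. V §3] [cite: Jacobowitz1962, §7] -/
theorem relIndex_fixed_mul_antifixed_le (hvσ : ∀ x, Valued.v (σ x) = Valued.v x)
    (hϖ : Valued.v ϖ = WithZero.exp (-1 : ℤ)) [Finite 𝓀[K]] {t : ℕ} (h2 : Valued.v (2 : K) = WithZero.exp (-(t : ℤ))) (m : ℕ) :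
    ((Valued.v : Valuation K ℤᵐ⁰).leAddSubgroup (WithZero.exp (-(m : ℤ))) ⊓ (AddMonoidHom.id K - σ.toAddMonoidHom).ker).relIndex
        ((Valued.v : Valuation K ℤᵐ⁰).leAddSubgroup 1 ⊓ (AddMonoidHom.id K - σ.toAddMonoidHom).ker) *
      ((Valued.v : Valuation K ℤᵐ⁰).leAddSubgroup (WithZero.exp (-(m : ℤ))) ⊓ (AddMonoidHom.id K + σ.toAddMonoidHom).ker).relIndex
        ((Valued.v : Valuation K ℤᵐ⁰).leAddSubgroup 1 ⊓ (AddMonoidHom.id K + σ.toAddMonoidHom).ker) ≤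
      Nat.card 𝓀[K] ^ (m + t) := by
  classical
  -- the six subgroups
  set A : AddSubgroup K := (Valued.v : Valuation K ℤᵐ⁰).leAddSubgroup 1 ⊓ (AddMonoidHom.id K - σ.toAddMonoidHom).ker with hA
  set A' : AddSubgroup K := (Valued.v : Valuation K ℤᵐ⁰).leAddSubgroup (WithZero.exp (-(m : ℤ))) ⊓ (AddMonoidHom.id K - σ.toAddMonoidHom).ker with hA'
  set B : AddSubgroup K := (Valued.v : Valuation K ℤᵐ⁰).leAddSubgroup 1 ⊓ (AddMonoidHom.id K + σ.toAddMonoidHom).ker with hB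
  set B' : AddSubgroup K := (Valued.v : Valuation K ℤᵐ⁰).leAddSubgroup (WithZero.exp (-(m : ℤ))) ⊓ (AddMonoidHom.id K + σ.toAddMonoidHom).ker with hB'
  set O : AddSubgroup K := (Valued.v : Valuation K ℤᵐ⁰).leAddSubgroup 1 with hO
  set O' : AddSubgroup K := (Valued.v : Valuation K ℤᵐ⁰).leAddSubgroup (WithZero.exp (-((m + t : ℕ) : ℤ))) with hO'
  -- the target quotient is finite of cardinality `q^{m+t}`
  have hOO : O'.relIndex O = Nat.card 𝓀[K] ^ (m + t) := by
    rw [hO', hO, ← WithZero.exp_zero, relIndex_leAddSubgroup_exp hϖ]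
    congr 1
    omega
  haveI : Finite (O ⧸ O'.addSubgroupOf O) := by
    apply Nat.finite_of_card_ne_zero
    change O'.relIndex O ≠ 0
    rw [hOO]; exact pow_ne_zero _ (Nat.card_pos (α := 𝓀[K])).ne'
  -- the injection `([a], [b]) ↦ [a + b]`
  have hmemO : ∀ (a : A) (b : B), (a : K) + (b : K) ∈ O := fun a b =>
    O.add_mem (AddSubgroup.mem_inf.1 a.2).1 (AddSubgroup.mem_inf.1 b.2).1
  let ι : (A ⧸ A'.addSubgroupOf A) × (B ⧸ B'.addSubgroupOf B) → O ⧸ O'.addSubgroupOf O := fun c =>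
    QuotientAddGroup.mk ⟨(c.1.out : K) + (c.2.out : K), hmemO _ _⟩
  have hι : Function.Injective ι := by
    rintro ⟨c₁, c₂⟩ ⟨d₁, d₂⟩ h
    simp only [ι] at h
    rw [QuotientAddGroup.eq, AddSubgroup.mem_addSubgroupOf] at h
    -- `y := (d₁.out + d₂.out) − (c₁.out + c₂.out)` is small
    set a₁ : K := (c₁.out : K); set a₂ : K := (c₂.out : K); set b₁ : K := (d₁.out : K); set b₂ : K := (d₂.out : K)
    have hy : Valued.v (-(a₁ + a₂) + (b₁ + b₂)) ≤ WithZero.exp (-((m + t : ℕ) : ℤ)) := by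
      have := h; rwa [hO', Valuation.mem_leAddSubgroup_iff] at this
    have ha₁ : σ a₁ = a₁ := (mem_ker_id_sub_iff _).1 (AddSubgroup.mem_inf.1 c₁.out.2).2
    have hb₁ : σ b₁ = b₁ := (mem_ker_id_sub_iff _).1 (AddSubgroup.mem_inf.1 d₁.out.2).2
    have ha₂ : σ a₂ = -a₂ := eq_neg_of_add_eq_zero_right ((mem_ker_id_add_iff _).1 (AddSubgroup.mem_inf.1 c₂.out.2).2)
    have hb₂ : σ b₂ = -b₂ := eq_neg_of_add_eq_zero_right ((mem_ker_id_add_iff _).1 (AddSubgroup.mem_inf.1 d₂.out.2).2)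
    have hσy : σ (-(a₁ + a₂) + (b₁ + b₂)) = -(a₁ - a₂) + (b₁ - b₂) := by
      rw [map_add, map_neg, map_add, map_add, ha₁, ha₂, hb₁, hb₂]; ring
    have hvσy : Valued.v (σ (-(a₁ + a₂) + (b₁ + b₂))) ≤ WithZero.exp (-((m + t : ℕ) : ℤ)) := by rw [hvσ]; exact hy
    -- the fixed part
    have h1 : Valued.v (-a₁ + b₁) ≤ WithZero.exp (-(m : ℤ)) := by
      refine v_le_of_v_two_mul_le h2 ?_
      have : 2 * (-a₁ + b₁) = (-(a₁ + a₂) + (b₁ + b₂)) + σ (-(a₁ + a₂) + (b₁ + b₂)) := by rw [hσy]; ring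
      rw [this, show ((m : ℤ) + t) = ((m + t : ℕ) : ℤ) by push_cast; ring]
      exact Valuation.map_add_le _ hy hvσy
    -- the anti-fixed part
    have h2' : Valued.v (-a₂ + b₂) ≤ WithZero.exp (-(m : ℤ)) := by
      refine v_le_of_v_two_mul_le h2 ?_
      have : 2 * (-a₂ + b₂) = (-(a₁ + a₂) + (b₁ + b₂)) - σ (-(a₁ + a₂) + (b₁ + b₂)) := by rw [hσy]; ring
      rw [this, show ((m : ℤ) + t) = ((m + t : ℕ) : ℤ) by push_cast; ring]
      exact Valuation.map_sub_le _ hy hvσy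
    -- conclude `c₁ = d₁`, `c₂ = d₂`
    have e₁ : c₁ = d₁ := by
      rw [← QuotientAddGroup.out_eq' c₁, ← QuotientAddGroup.out_eq' d₁, QuotientAddGroup.eq, AddSubgroup.mem_addSubgroupOf]
      exact AddSubgroup.mem_inf.2 ⟨Valuation.mem_leAddSubgroup_iff.2 h1,
        ((AddMonoidHom.id K - σ.toAddMonoidHom).ker).add_mem (((AddMonoidHom.id K - σ.toAddMonoidHom).ker).neg_mem (AddSubgroup.mem_inf.1 c₁.out.2).2)
          (AddSubgroup.mem_inf.1 d₁.out.2).2⟩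
    have e₂ : c₂ = d₂ := by
      rw [← QuotientAddGroup.out_eq' c₂, ← QuotientAddGroup.out_eq' d₂, QuotientAddGroup.eq, AddSubgroup.mem_addSubgroupOf]
      exact AddSubgroup.mem_inf.2 ⟨Valuation.mem_leAddSubgroup_iff.2 h2',
        ((AddMonoidHom.id K + σ.toAddMonoidHom).ker).add_mem (((AddMonoidHom.id K + σ.toAddMonoidHom).ker).neg_mem (AddSubgroup.mem_inf.1 c₂.out.2).2)
          (AddSubgroup.mem_inf.1 d₂.out.2).2⟩
    rw [e₁, e₂]
  have hcard := Nat.card_le_card_of_injective ι hι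
  rw [Nat.card_prod] at hcard
  have hOO' : Nat.card (O ⧸ O'.addSubgroupOf O) = Nat.card 𝓀[K] ^ (m + t) := hOO
  rw [hOO'] at hcard
  exact hcard

/-! ## §4 The bound `[L_1 : L_{exp(−2j)}] ≤ q^{k+t} · q^j` -/

/-- **`[L_1 : L_{exp(−i)}]² ≤ q^{k+i+t}`** for `σ θ = −θ`, `v θ = exp(−k)`, `v 2 = exp(−t)`: with `m = k + i`, `b_i := [L_1 : L_{exp(−i)}] = [F_{−k} : F_{−m}] ≤
[F_1 : F_{−m}]` (swap + tower) and `b_i ≤ [L_1 : L_{−m}]` (monotonicity), so `b_i² ≤ [F_1 : F_{−m}]·[L_1 : L_{−m}] ≤ q^{m+t}` (§3).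
[cite: Serre1979, Ch. II §3 Prop. 5, Ch. V §3] [cite: Jacobowitz1962, §§7–9] -/
theorem relIndex_antifixedBall_sq_le (hvσ : ∀ x, Valued.v (σ x) = Valued.v x)
    (hϖ : Valued.v ϖ = WithZero.exp (-1 : ℤ)) [Finite 𝓀[K]] {t : ℕ} (h2 : Valued.v (2 : K) = WithZero.exp (-(t : ℤ)))
    {θ : K} {k : ℕ} (hθ : σ θ = -θ) (hθ0 : θ ≠ 0) (hvθ : Valued.v θ = WithZero.exp (-(k : ℤ))) (i : ℕ) :
    ((Valued.v : Valuation K ℤᵐ⁰).leAddSubgroup (WithZero.exp (-(i : ℤ))) ⊓ (AddMonoidHom.id K + σ.toAddMonoidHom).ker).relIndex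
        ((Valued.v : Valuation K ℤᵐ⁰).leAddSubgroup 1 ⊓ (AddMonoidHom.id K + σ.toAddMonoidHom).ker) ^ 2 ≤
      Nat.card 𝓀[K] ^ (k + i + t) := by
  -- shorthand for the balls
  set Lam : ℕ → AddSubgroup K := fun n => (Valued.v : Valuation K ℤᵐ⁰).leAddSubgroup (WithZero.exp (-(n : ℤ))) ⊓ (AddMonoidHom.id K + σ.toAddMonoidHom).ker
    with hLam
  set L1 : AddSubgroup K := (Valued.v : Valuation K ℤᵐ⁰).leAddSubgroup 1 ⊓ (AddMonoidHom.id K + σ.toAddMonoidHom).ker with hL1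
  set Fam : ℕ → AddSubgroup K := fun n => (Valued.v : Valuation K ℤᵐ⁰).leAddSubgroup (WithZero.exp (-(n : ℤ))) ⊓ (AddMonoidHom.id K - σ.toAddMonoidHom).ker
    with hFam
  set F1 : AddSubgroup K := (Valued.v : Valuation K ℤᵐ⁰).leAddSubgroup 1 ⊓ (AddMonoidHom.id K - σ.toAddMonoidHom).ker with hF1
  change ((Lam i).relIndex L1) ^ 2 ≤ _
  have hL0 : Lam 0 = L1 := by simp only [hLam, hL1, Nat.cast_zero, neg_zero, WithZero.exp_zero]
  have hF0 : Fam 0 = F1 := by simp only [hFam, hF1, Nat.cast_zero, neg_zero, WithZero.exp_zero]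
  have hLmono : ∀ {a b : ℕ}, a ≤ b → Lam b ≤ Lam a := fun {a b} hab =>
    inf_le_inf_right _ (Valuation.leAddSubgroup_monotone _ (WithZero.exp_le_exp.2 (by omega)))
  have hFmono : ∀ {a b : ℕ}, a ≤ b → Fam b ≤ Fam a := fun {a b} hab =>
    inf_le_inf_right _ (Valuation.leAddSubgroup_monotone _ (WithZero.exp_le_exp.2 (by omega)))
  -- the swap: `[F_k : F_{k+i}] = b_i`
  have hswap : (Fam (k + i)).relIndex (Fam k) = (Lam i).relIndex L1 := by
    have h := relIndex_fixedBall_shift_eq hθ hθ0 (WithZero.exp (-(i : ℤ)))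
    rw [hvθ, ← WithZero.exp_add] at h
    rw [← h, hFam]
    congr 3
    push_cast; ring
  -- the tower: `[F_1 : F_{k+i}] = [F_1 : F_k] · [F_k : F_{k+i}]`, so `b_i ≤ [F_1 : F_{k+i}]`
  have htower : (Fam (k + i)).relIndex (Fam k) * (Fam k).relIndex F1 = (Fam (k + i)).relIndex F1 :=
    AddSubgroup.relIndex_mul_relIndex _ _ _ (hFmono (Nat.le_add_right k i)) (hF0 ▸ hFmono (Nat.zero_le k))
  have hFk0 : (Fam k).relIndex F1 ≠ 0 := (relIndex_ball_inf_le hϖ k _).1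
  have hb_le_a : (Lam i).relIndex L1 ≤ (Fam (k + i)).relIndex F1 := by
    rw [← hswap, ← htower]
    exact Nat.le_mul_of_pos_right _ (Nat.pos_of_ne_zero hFk0)
  -- monotonicity: `b_i ≤ b_{k+i}`
  have hb_le_b : (Lam i).relIndex L1 ≤ (Lam (k + i)).relIndex L1 :=
    AddSubgroup.relIndex_le_of_le_left (hLmono (Nat.le_add_left i k)) (relIndex_ball_inf_le hϖ (k + i) _).1
  -- the product bound
  have hprod := relIndex_fixed_mul_antifixed_le hvσ hϖ h2 (k + i)
  calc ((Lam i).relIndex L1) ^ 2 = (Lam i).relIndex L1 * (Lam i).relIndex L1 := sq _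
    _ ≤ (Fam (k + i)).relIndex F1 * (Lam (k + i)).relIndex L1 := Nat.mul_le_mul hb_le_a hb_le_b
    _ ≤ Nat.card 𝓀[K] ^ (k + i + t) := hprod

/-- **THE VOLUME EXPONENT AT ANY PLACE: `[𝒪⁰ : 𝒪⁰ ∩ 𝔭^{2j}] ≤ D · q^j`** with `D = q^{k+t}` independent of `j` (`σ` ANY involution with `v ∘ σ = v` and `σ ≠ id`;
`v 2 = exp(−t)`; `k` the order of an anti-fixed integral element), and all these indices are non-zero.  This is the `Q = q_w` growth of the rank-one Cartan volumes
at an isotropic non-split place of #32dR (inert: `q_w = q_v²`; ramified: `q_w = q_v`). [cite: Serre1979, Ch. II §3 Prop. 5, Ch. V §3] [cite: Jacobowitz1962, §§7–9] -/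
theorem exists_relIndex_antifixedBall_le (hσ : ∀ x, σ (σ x) = x) (hvσ : ∀ x, Valued.v (σ x) = Valued.v x)
    (hϖ : Valued.v ϖ = WithZero.exp (-1 : ℤ)) [Finite 𝓀[K]] {t : ℕ} (h2 : Valued.v (2 : K) = WithZero.exp (-(t : ℤ))) (hne : ∃ x : K, σ x ≠ x) :
    ∃ D : ℕ, 0 < D ∧ ∀ j : ℕ,
      ((Valued.v : Valuation K ℤᵐ⁰).leAddSubgroup (WithZero.exp (-(2 * (j : ℤ)))) ⊓ (AddMonoidHom.id K + σ.toAddMonoidHom).ker).relIndex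
          ((Valued.v : Valuation K ℤᵐ⁰).leAddSubgroup 1 ⊓ (AddMonoidHom.id K + σ.toAddMonoidHom).ker) ≠ 0 ∧
      ((Valued.v : Valuation K ℤᵐ⁰).leAddSubgroup (WithZero.exp (-(2 * (j : ℤ)))) ⊓ (AddMonoidHom.id K + σ.toAddMonoidHom).ker).relIndex
          ((Valued.v : Valuation K ℤᵐ⁰).leAddSubgroup 1 ⊓ (AddMonoidHom.id K + σ.toAddMonoidHom).ker) ≤ D * Nat.card 𝓀[K] ^ j := by
  obtain ⟨θ, k, hθ, hθ0, hvθ⟩ := exists_antifixed_integral hσ hvσ hϖ hne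
  have hq : 0 < Nat.card 𝓀[K] := Nat.card_pos
  refine ⟨Nat.card 𝓀[K] ^ (k + t), pow_pos hq _, fun j => ⟨?_, ?_⟩⟩
  · have h := (relIndex_ball_inf_le hϖ (2 * j) ((AddMonoidHom.id K + σ.toAddMonoidHom).ker)).1
    rwa [show (((2 * j : ℕ) : ℤ)) = 2 * (j : ℤ) by push_cast; ring] at h
  · have hsq := relIndex_antifixedBall_sq_le hvσ hϖ h2 hθ hθ0 hvθ (2 * j)
    rw [show (((2 * j : ℕ) : ℤ)) = 2 * (j : ℤ) by push_cast; ring] at hsq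
    -- `b² ≤ q^{k+2j+t} ≤ (q^{k+t} q^j)²`
    have hle : Nat.card 𝓀[K] ^ (k + 2 * j + t) ≤ (Nat.card 𝓀[K] ^ (k + t) * Nat.card 𝓀[K] ^ j) ^ 2 := by
      rw [← pow_add, ← pow_mul]
      exact Nat.pow_le_pow_right hq (by omega)
    exact (Nat.pow_le_pow_iff_left (by norm_num : (2 : ℕ) ≠ 0)).1 (hsq.trans hle)

/-! ## §5 Nets from finite index -/

/-- **representatives**: for additive subgroups `T ≤ S` of an abelian group with `[S : T] ≠ 0` there is a finite `R₀ ⊆ S` with `#R₀ ≤ [S : T]` such that every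
`ρ ∈ S` is `≡ ρ' (mod T)` for some `ρ' ∈ R₀`. [folklore] -/
theorem exists_net_of_relIndex_ne_zero {G : Type*} [AddCommGroup G] (S T : AddSubgroup G) (hfin : T.relIndex S ≠ 0) :
    ∃ R₀ : Finset G, R₀.card ≤ T.relIndex S ∧ (∀ ρ ∈ R₀, ρ ∈ S) ∧ ∀ ρ ∈ S, ∃ ρ' ∈ R₀, ρ - ρ' ∈ T := by
  classical
  haveI : Finite (S ⧸ T.addSubgroupOf S) := Nat.finite_of_card_ne_zero hfin
  letI : Fintype (S ⧸ T.addSubgroupOf S) := Fintype.ofFinite _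
  refine ⟨(Finset.univ : Finset (S ⧸ T.addSubgroupOf S)).image fun c => ((c.out : S) : G), ?_, ?_, ?_⟩
  · refine Finset.card_image_le.trans ?_
    rw [Finset.card_univ, ← Nat.card_eq_fintype_card]
    exact le_rfl
  · intro ρ hρ
    obtain ⟨c, -, rfl⟩ := Finset.mem_image.1 hρ
    exact (c.out).2
  · intro ρ hρ
    set c : S ⧸ T.addSubgroupOf S := QuotientAddGroup.mk ⟨ρ, hρ⟩ with hc
    refine ⟨((c.out : S) : G), Finset.mem_image.2 ⟨c, Finset.mem_univ _, rfl⟩, ?_⟩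
    have h : (QuotientAddGroup.mk (c.out) : S ⧸ T.addSubgroupOf S) = QuotientAddGroup.mk ⟨ρ, hρ⟩ := by rw [QuotientAddGroup.out_eq', hc]
    rw [QuotientAddGroup.eq, AddSubgroup.mem_addSubgroupOf] at h
    have h' : (-((c.out : S) : G) + ρ) ∈ T := h
    rwa [neg_add_eq_sub] at h'

end Summit.HodgeConjecture.HodgeConjecture.Cruxes.HLiu418.K2LiuAntifixedLatticeIndex

end
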